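import Summits.ResolutionOfSingularities.ResolutionOfSingularities.Theorems.FrobeniusLadderFInjectiveMacaulayficationOmegaOneGlobalCureFanCert
import Summits.ResolutionOfSingularities.ResolutionOfSingularities.Theorems.FrobeniusLadderFInjectiveMacaulayficationFanCheckSound
import Summits.ResolutionOfSingularities.ResolutionOfSingularities.Theorems.FrobeniusLadderFInjectiveMacaulayficationOmegaOneS2KNewtonKFanTables
import HarnessLib

/-!
# WHAT THE EXIT TAGS SAY: Boolean → Prop soundness of ✓ `OmegaOneCureFanCertStrong.exitOKW'`, and the per-(cone, orbit) unpacking of ✓ `cert_S2_exits`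
# (BED Ω₁ GLOBAL PATCH, F6 v2 (C) «table semantics»; crux `FInjectiveMacaulayfication` stmt-ResolutionOfSingularities-15315, chain w45a; seat res-L1-w45a-stub-3 g15)

[OURS · L1 W4.5a] Support file (`--supports stmt-ResolutionOfSingularities-15315 --as helper`); theorems only; list bookkeeping + `decide` certificates; no named fact; NOT a statement of any
manuscript; nothing of the crux is proved. AI-written (AI review is weaker than expert review).
* §1 primitives: `getL` of `vmin`/`vsub`/`vadd`/`rows.map (dotL · w)`, `allLe (onZ Z v) b ↔ ∀ i ∈ Z, v_i ≤ b`, `(onZ Z v).any (0 < ·) ↔ ∃ i ∈ Z, 0 < v_i`.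
* §2 ★ `exitOKW'_sound` — for ANY weight data: `exitOKW' n CW P Q rows Z t = true` implies, with `C_i = ⟨row_i, CW⟩`, `A_i = ⟨row_i, P⟩`, `B_i = ⟨row_i, Q⟩`, `m = min(A,B)`, `r = A − m`,
  `s = B − m`, `G = min(C, m)`, `M₁ = C − G`, `M₂ = m − G` (all read through `getL … i 0`): tag 0 ⇒ `M₁|Z = 0`; tag 1 ⇒ ¬deep ∧ nonpdiv ∧ `M₂|Z ≤ 1`; tag 2 ⇒ ¬deep ∧ nonpdiv ∧ `M₁|Z ≤ 1`;
  tag 3 ⇒ ¬deep ∧ nonpdiv ∧ `M₁|Z, M₂|Z ≤ 2`; tag 4 ⇒ deep ∧ `M₁|Z ≤ 1`; tag 5 ⇒ deep ∧ `(M₂+r)|Z ≤ 1` ∧ `∃ i ∈ Z, M₁ i > 0 ∧ r i = 0`; tags ≥ 6 reported as `6 ≤ t`.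
* §3 S2 certificates (`decide +kernel`): the F5 tables and the K″-chart tables agree (`RAYS_S2 = RAYS`, `CONES_S2 = CL.map (·.1)`); shapes; every orbit `Z ⊆ Fin 5` has an `ORB5` index;
  no tag 6–8 occurs; ★★ `tag_S2_spec` — for every cone `c` and orbit index `zi`: if the orbit is relevant the recorded tag passes `exitOKW'`, else the tag is `9`.
[cite: CoxLittleSchenck2011, §11.1 (bookkeeping only)]
-/

set_option linter.dupNamespace false
set_option linter.style.longLine false

namespace Summit.ResolutionOfSingularities.ResolutionOfSingularities.Theorems.FInjectiveMacaulayfication.ExitTagSemantics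

open Summit.ResolutionOfSingularities.ResolutionOfSingularities.Theorems.FInjectiveMacaulayfication
open FanCheckKit FanCheckSound OmegaOneCureFanCert OmegaOneCureFanCertStrong OmegaOneGlobalCureFanCert

/-! ## §1 Primitives -/

/-- `getL (vmin a b) i 0 = min a_i b_i` for lists of equal length. [plumbing] -/
theorem getL_vmin : ∀ (a b : List ℕ), a.length = b.length → ∀ i : ℕ, getL (vmin a b) i 0 = min (getL a i 0) (getL b i 0)
  | [], [], _, i => by simp [vmin, getL_nil]
  | [], _ :: _, h, _ => by simp at h
  | _ :: _, [], h, _ => by simp at h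
  | x :: xs, y :: ys, h, 0 => by simp [vmin, getL_cons_zero]
  | x :: xs, y :: ys, h, i + 1 => by
    have ih := getL_vmin xs ys (by simpa using h) i
    simp only [vmin, List.zip_cons_cons, List.map_cons, getL_cons_succ] at ih ⊢
    exact ih

/-- `getL (vsub a b) i 0 = a_i − b_i` for lists of equal length. [plumbing] -/
theorem getL_vsub : ∀ (a b : List ℕ), a.length = b.length → ∀ i : ℕ, getL (vsub a b) i 0 = getL a i 0 - getL b i 0
  | [], [], _, i => by simp [vsub, getL_nil]
  | [], _ :: _, h, _ => by simp at h
  | _ :: _, [], h, _ => by simp at h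
  | x :: xs, y :: ys, h, 0 => by simp [vsub, getL_cons_zero]
  | x :: xs, y :: ys, h, i + 1 => by
    have ih := getL_vsub xs ys (by simpa using h) i
    simp only [vsub, List.zip_cons_cons, List.map_cons, getL_cons_succ] at ih ⊢
    exact ih

/-- `getL (vadd a b) i 0 = a_i + b_i` for lists of equal length. [plumbing] -/
theorem getL_vadd : ∀ (a b : List ℕ), a.length = b.length → ∀ i : ℕ, getL (vadd a b) i 0 = getL a i 0 + getL b i 0
  | [], [], _, i => by simp [vadd, getL_nil]
  | [], _ :: _, h, _ => by simp at h
  | _ :: _, [], h, _ => by simp at h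
  | x :: xs, y :: ys, h, 0 => by simp [vadd, getL_cons_zero]
  | x :: xs, y :: ys, h, i + 1 => by
    have ih := getL_vadd xs ys (by simpa using h) i
    simp only [vadd, List.zip_cons_cons, List.map_cons, getL_cons_succ] at ih ⊢
    exact ih

/-- Lengths of `vmin`, `vsub`, `vadd` on lists of equal length. [plumbing] -/
theorem length_vmin_vsub_vadd (a b : List ℕ) (h : a.length = b.length) :
    (vmin a b).length = a.length ∧ (vsub a b).length = a.length ∧ (vadd a b).length = a.length := by
  simp [vmin, vsub, vadd, List.length_zip, h]

/-- `getL (rows.map (dotL · w)) i 0 = dotL (row_i) w` (everywhere, as `dotL [] w = 0`). [plumbing] -/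
theorem getL_map_dotL (rows : List (List ℕ)) (w : List ℕ) (i : ℕ) : getL (rows.map fun ρ => dotL ρ w) i 0 = dotL (getL rows i []) w :=
  getL_map_of_apply_default (fun ρ => dotL ρ w) [] 0 (by cases w <;> rfl) rows i

/-- `allLe (onZ Z v) b ↔ ∀ i ∈ Z, v_i ≤ b`. [plumbing] -/
theorem allLe_onZ_iff (Z v : List ℕ) (b : ℕ) : allLe (onZ Z v) b = true ↔ ∀ i ∈ Z, getL v i 0 ≤ b := by
  simp [allLe, onZ, List.all_eq_true, Nat.ble_eq]

/-- `allLe (vadd (onZ Z v₁) (onZ Z v₂)) b ↔ ∀ i ∈ Z, v₁_i + v₂_i ≤ b`. [plumbing] -/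
theorem allLe_vadd_onZ_iff (Z v₁ v₂ : List ℕ) (b : ℕ) : allLe (vadd (onZ Z v₁) (onZ Z v₂)) b = true ↔ ∀ i ∈ Z, getL v₁ i 0 + getL v₂ i 0 ≤ b := by
  induction Z with
  | nil => simp [allLe, vadd, onZ]
  | cons j Z ih =>
    simp only [allLe, vadd, onZ] at ih
    simp only [allLe, vadd, onZ, List.map_cons, List.zip_cons_cons, List.all_cons, Bool.and_eq_true, Nat.ble_eq, List.mem_cons, forall_eq_or_imp, ih]

/-- `(onZ Z v).any (0 < ·) ↔ ∃ i ∈ Z, 0 < v_i`. [plumbing] -/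
theorem any_onZ_iff (Z v : List ℕ) : ((onZ Z v).any fun x => Nat.blt 0 x) = true ↔ ∃ i ∈ Z, 0 < getL v i 0 := by
  simp [onZ, List.any_eq_true]

/-! ## §2 ★ Soundness of `exitOKW'` -/

/-- ★ **WHAT `exitOKW'` CERTIFIES** (any `n`, any weights). See the module docstring. [OURS · bookkeeping] -/
theorem exitOKW'_sound (n : ℕ) (CW P Q : List ℕ) (rows : List (List ℕ)) (Z : List ℕ) (t : ℕ) (h : exitOKW' n CW P Q rows Z t = true) :
    let Cg : ℕ → ℕ := fun i => dotL (getL rows i []) CW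
    let Ag : ℕ → ℕ := fun i => dotL (getL rows i []) P
    let Bg : ℕ → ℕ := fun i => dotL (getL rows i []) Q
    let rg : ℕ → ℕ := fun i => Ag i - min (Ag i) (Bg i)
    let sg : ℕ → ℕ := fun i => Bg i - min (Ag i) (Bg i)
    let M1g : ℕ → ℕ := fun i => Cg i - min (Cg i) (min (Ag i) (Bg i))
    let M2g : ℕ → ℕ := fun i => min (Ag i) (Bg i) - min (Cg i) (min (Ag i) (Bg i))
    let deepP : Prop := (∃ i ∈ Z, 0 < rg i) ∧ (∃ i ∈ Z, 0 < sg i)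
    let nonpdivP : Prop := (∃ i ∈ Z, 0 < rg i) ∨ (∃ i ∈ Z, 0 < sg i) ∨ ∃ i, i < n ∧ i ∉ Z ∧ 1 ≤ (rg i - sg i) + (sg i - rg i) ∧ (rg i - sg i) + (sg i - rg i) ≤ 4
    (t = 0 ∧ ∀ i ∈ Z, M1g i = 0) ∨
    (t = 1 ∧ ¬ deepP ∧ nonpdivP ∧ ∀ i ∈ Z, M2g i ≤ 1) ∨
    (t = 2 ∧ ¬ deepP ∧ nonpdivP ∧ ∀ i ∈ Z, M1g i ≤ 1) ∨
    (t = 3 ∧ ¬ deepP ∧ nonpdivP ∧ (∀ i ∈ Z, M1g i ≤ 2) ∧ ∀ i ∈ Z, M2g i ≤ 2) ∨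
    (t = 4 ∧ deepP ∧ ∀ i ∈ Z, M1g i ≤ 1) ∨
    (t = 5 ∧ deepP ∧ (∀ i ∈ Z, M2g i + rg i ≤ 1) ∧ ∃ i ∈ Z, 0 < M1g i ∧ rg i = 0) ∨
    6 ≤ t := by
  intro Cg Ag Bg rg sg M1g M2g deepP nonpdivP
  have hW := exitOKW_of_exitOKW' n CW P Q rows Z t h
  -- list-level dictionary
  have hlA : (rows.map fun ρ => dotL ρ P).length = rows.length := List.length_map _
  have hlB : (rows.map fun ρ => dotL ρ Q).length = rows.length := List.length_map _
  have hlC : (rows.map fun ρ => dotL ρ CW).length = rows.length := List.length_map _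
  have hlm : (vmin (rows.map fun ρ => dotL ρ P) (rows.map fun ρ => dotL ρ Q)).length = rows.length :=
    (length_vmin_vsub_vadd _ _ (hlA.trans hlB.symm)).1.trans hlA
  have hlG : (vmin (rows.map fun ρ => dotL ρ CW) (vmin (rows.map fun ρ => dotL ρ P) (rows.map fun ρ => dotL ρ Q))).length = rows.length :=
    (length_vmin_vsub_vadd _ _ (hlC.trans hlm.symm)).1.trans hlC
  have em : ∀ i, getL (vmin (rows.map fun ρ => dotL ρ P) (rows.map fun ρ => dotL ρ Q)) i 0 = min (Ag i) (Bg i) := fun i => by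
    rw [getL_vmin _ _ (hlA.trans hlB.symm), getL_map_dotL, getL_map_dotL]
  have er : ∀ i, getL (vsub (rows.map fun ρ => dotL ρ P) (vmin (rows.map fun ρ => dotL ρ P) (rows.map fun ρ => dotL ρ Q))) i 0 = rg i := fun i => by
    rw [getL_vsub _ _ (hlA.trans hlm.symm), em, getL_map_dotL]
  have es : ∀ i, getL (vsub (rows.map fun ρ => dotL ρ Q) (vmin (rows.map fun ρ => dotL ρ P) (rows.map fun ρ => dotL ρ Q))) i 0 = sg i := fun i => by
    rw [getL_vsub _ _ (hlB.trans hlm.symm), em, getL_map_dotL]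
  have eG : ∀ i, getL (vmin (rows.map fun ρ => dotL ρ CW) (vmin (rows.map fun ρ => dotL ρ P) (rows.map fun ρ => dotL ρ Q))) i 0 = min (Cg i) (min (Ag i) (Bg i)) := fun i => by
    rw [getL_vmin _ _ (hlC.trans hlm.symm), getL_map_dotL, em]
  have eM1 : ∀ i, getL (vsub (rows.map fun ρ => dotL ρ CW) (vmin (rows.map fun ρ => dotL ρ CW) (vmin (rows.map fun ρ => dotL ρ P) (rows.map fun ρ => dotL ρ Q)))) i 0 = M1g i := fun i => by
    rw [getL_vsub _ _ (hlC.trans hlG.symm), getL_map_dotL, eG]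
  have eM2 : ∀ i, getL (vsub (vmin (rows.map fun ρ => dotL ρ P) (rows.map fun ρ => dotL ρ Q)) (vmin (rows.map fun ρ => dotL ρ CW) (vmin (rows.map fun ρ => dotL ρ P) (rows.map fun ρ => dotL ρ Q)))) i 0 = M2g i := fun i => by
    rw [getL_vsub _ _ (hlm.trans hlG.symm), em, eG]
  -- Boolean dictionary
  have dRZ : ((onZ Z (vsub (rows.map fun ρ => dotL ρ P) (vmin (rows.map fun ρ => dotL ρ P) (rows.map fun ρ => dotL ρ Q)))).any fun x => Nat.blt 0 x) = true ↔ ∃ i ∈ Z, 0 < rg i := by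
    rw [any_onZ_iff]; simp only [er]
  have dSZ : ((onZ Z (vsub (rows.map fun ρ => dotL ρ Q) (vmin (rows.map fun ρ => dotL ρ P) (rows.map fun ρ => dotL ρ Q)))).any fun x => Nat.blt 0 x) = true ↔ ∃ i ∈ Z, 0 < sg i := by
    rw [any_onZ_iff]; simp only [es]
  have dU : (((List.range n).filter fun i => !(Z.any fun j => Nat.beq j i)).any fun i =>
      Nat.ble 1 ((getL (vsub (rows.map fun ρ => dotL ρ P) (vmin (rows.map fun ρ => dotL ρ P) (rows.map fun ρ => dotL ρ Q))) i 0 -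
        getL (vsub (rows.map fun ρ => dotL ρ Q) (vmin (rows.map fun ρ => dotL ρ P) (rows.map fun ρ => dotL ρ Q))) i 0) +
        (getL (vsub (rows.map fun ρ => dotL ρ Q) (vmin (rows.map fun ρ => dotL ρ P) (rows.map fun ρ => dotL ρ Q))) i 0 -
        getL (vsub (rows.map fun ρ => dotL ρ P) (vmin (rows.map fun ρ => dotL ρ P) (rows.map fun ρ => dotL ρ Q))) i 0)) &&
      Nat.ble ((getL (vsub (rows.map fun ρ => dotL ρ P) (vmin (rows.map fun ρ => dotL ρ P) (rows.map fun ρ => dotL ρ Q))) i 0 -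
        getL (vsub (rows.map fun ρ => dotL ρ Q) (vmin (rows.map fun ρ => dotL ρ P) (rows.map fun ρ => dotL ρ Q))) i 0) +
        (getL (vsub (rows.map fun ρ => dotL ρ Q) (vmin (rows.map fun ρ => dotL ρ P) (rows.map fun ρ => dotL ρ Q))) i 0 -
        getL (vsub (rows.map fun ρ => dotL ρ P) (vmin (rows.map fun ρ => dotL ρ P) (rows.map fun ρ => dotL ρ Q))) i 0)) 4) = true ↔
      ∃ i, i < n ∧ i ∉ Z ∧ 1 ≤ (rg i - sg i) + (sg i - rg i) ∧ (rg i - sg i) + (sg i - rg i) ≤ 4 := by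
    simp only [List.any_eq_true, List.mem_filter, List.mem_range, Bool.and_eq_true, Bool.not_eq_true', List.any_eq_false, Nat.beq_eq,
      Nat.ble_eq, er, es]
    constructor
    · rintro ⟨i, ⟨hi, hiZ⟩, h1, h2⟩; exact ⟨i, hi, fun hz => hiZ i hz rfl, h1, h2⟩
    · rintro ⟨i, hi, hiZ, h1, h2⟩; exact ⟨i, ⟨hi, fun j hj hji => hiZ (hji ▸ hj)⟩, h1, h2⟩
  -- case analysis on the tag
  rcases t with (_ | _ | _ | _ | _ | _ | t)
  · left
    refine ⟨rfl, ?_⟩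
    simp only [exitOKW] at hW
    rw [allLe_onZ_iff] at hW
    intro i hi; have := hW i hi; rw [eM1] at this; omega
  · right; left
    refine ⟨rfl, ?_⟩
    simp only [exitOKW, Bool.and_eq_true, Bool.not_eq_true', Bool.or_eq_true] at hW
    obtain ⟨⟨hnd, hnp⟩, hle⟩ := hW
    refine ⟨?_, ?_, ?_⟩
    · intro ⟨h1, h2⟩
      have : (_ && _) = true := Bool.and_eq_true_iff.mpr ⟨dRZ.mpr h1, dSZ.mpr h2⟩
      rw [hnd] at this; exact Bool.false_ne_true this
    · rcases hnp with (h1 | h2) | h3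
      · exact Or.inl (dRZ.mp h1)
      · exact Or.inr (Or.inl (dSZ.mp h2))
      · exact Or.inr (Or.inr (dU.mp h3))
    · rw [allLe_onZ_iff] at hle; intro i hi; rw [← eM2]; exact hle i hi
  · right; right; left
    refine ⟨rfl, ?_⟩
    simp only [exitOKW, Bool.and_eq_true, Bool.not_eq_true', Bool.or_eq_true] at hW
    obtain ⟨⟨hnd, hnp⟩, hle⟩ := hW
    refine ⟨?_, ?_, ?_⟩
    · intro ⟨h1, h2⟩
      have : (_ && _) = true := Bool.and_eq_true_iff.mpr ⟨dRZ.mpr h1, dSZ.mpr h2⟩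
      rw [hnd] at this; exact Bool.false_ne_true this
    · rcases hnp with (h1 | h2) | h3
      · exact Or.inl (dRZ.mp h1)
      · exact Or.inr (Or.inl (dSZ.mp h2))
      · exact Or.inr (Or.inr (dU.mp h3))
    · rw [allLe_onZ_iff] at hle; intro i hi; rw [← eM1]; exact hle i hi
  · right; right; right; left
    refine ⟨rfl, ?_⟩
    simp only [exitOKW, Bool.and_eq_true, Bool.not_eq_true', Bool.or_eq_true] at hW
    obtain ⟨⟨⟨hnd, hnp⟩, hle1⟩, hle2⟩ := hW
    refine ⟨?_, ?_, ?_, ?_⟩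
    · intro ⟨h1, h2⟩
      have : (_ && _) = true := Bool.and_eq_true_iff.mpr ⟨dRZ.mpr h1, dSZ.mpr h2⟩
      rw [hnd] at this; exact Bool.false_ne_true this
    · rcases hnp with (h1 | h2) | h3
      · exact Or.inl (dRZ.mp h1)
      · exact Or.inr (Or.inl (dSZ.mp h2))
      · exact Or.inr (Or.inr (dU.mp h3))
    · rw [allLe_onZ_iff] at hle1; intro i hi; rw [← eM1]; exact hle1 i hi
    · rw [allLe_onZ_iff] at hle2; intro i hi; rw [← eM2]; exact hle2 i hi
  · right; right; right; right; left
    refine ⟨rfl, ?_⟩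
    simp only [exitOKW, Bool.and_eq_true] at hW
    obtain ⟨⟨h1, h2⟩, hle⟩ := hW
    refine ⟨⟨dRZ.mp h1, dSZ.mp h2⟩, ?_⟩
    rw [allLe_onZ_iff] at hle; intro i hi; rw [← eM1]; exact hle i hi
  · right; right; right; right; right; left
    refine ⟨rfl, ?_⟩
    have hiso := isoLetterW_of_exitOKW'_five n CW P Q rows Z h
    simp only [exitOKW, Bool.and_eq_true] at hW
    obtain ⟨⟨h1, h2⟩, hle⟩ := hW
    refine ⟨⟨dRZ.mp h1, dSZ.mp h2⟩, ?_, ?_⟩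
    · rw [allLe_vadd_onZ_iff] at hle; intro i hi; rw [← eM2, ← er]; exact hle i hi
    · simp only [isoLetterW, List.any_eq_true, Bool.and_eq_true, Nat.blt_eq, Nat.beq_eq, Bool.false_eq_true, if_false] at hiso
      obtain ⟨i, hi, hM, hr⟩ := hiso
      refine ⟨i, hi, ?_, ?_⟩
      · rw [← eM1]; exact hM
      · rw [← er]; exact hr
  · right; right; right; right; right; right
    omega

/-! ## §3 The S2 certificates -/

/-- The F5 fan tables and the K″-chart tables are the SAME fan in the SAME numbering. [certificate] -/
theorem tables_agree : RAYS_S2 = OmegaOneS2KNewtonKFan.RAYS ∧ CONES_S2 = OmegaOneS2KNewtonKFan.CL.map (·.1) := by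
  constructor <;> decide +kernel

/-- Shapes: 25 class-centre weights of length 5, parents `< 25`, cone indices `< 139`, rays of length 5, `1223 × 31` tags, no tag in `{6, 7, 8}`. [certificate] -/
theorem shapes_S2 : CWS_S2.length = 25 ∧ allLen 5 CWS_S2 = true ∧ (PARENT_S2.all fun q => Nat.blt q 25) = true ∧ PARENT_S2.length = 1223 ∧
    (CONES_S2.all fun cn => cn.all fun j => Nat.blt j 139) = true ∧ allLen 5 RAYS_S2 = true ∧ RAYS_S2.length = 139 ∧ CONES_S2.length = 1223 ∧ allLen 5 CONES_S2 = true ∧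
    TAGS_S2.length = 1223 ∧ allLen 31 TAGS_S2 = true ∧ (TAGS_S2.all fun tg => tg.all fun t => Nat.ble t 5 || Nat.beq t 9) = true ∧ ORB5.length = 31 := by
  refine ⟨?_, ?_, ?_, ?_, ?_, ?_, ?_, ?_, ?_, ?_, ?_, ?_, ?_⟩ <;> decide +kernel

/-- Every non-empty `Z ⊆ Fin 5` is one of the 31 orbits of `ORB5`. [certificate] -/
theorem exists_orb_index : ∀ Z : Finset (Fin 5), Z.Nonempty → ∃ zi : Fin 31, ∀ i : Fin 5, i ∈ Z ↔ (i : ℕ) ∈ getL ORB5 zi [] := by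
  decide

/-- Members of `ORB5` orbits are `< 5`. [certificate] -/
theorem orb_lt : ∀ zi : Fin 31, ∀ i ∈ getL ORB5 zi [], i < 5 := by
  decide

/-- `allLen n L` unpacked. [plumbing] -/
theorem length_of_allLen {n : ℕ} {L : List (List ℕ)} (h : allLen n L = true) : ∀ l ∈ L, l.length = n := by
  intro l hl
  simp only [allLen, List.all_eq_true, Nat.beq_eq] at h
  exact h l hl

/-- ★★ **THE RECORDED TAG OF EVERY (cone, orbit) PAIR PASSES `exitOKW'` (relevant orbits) OR IS `9` (irrelevant orbits).** [certificate, unpacked from ✓ `cert_S2_exits`] -/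
theorem tag_S2_spec (c : Fin 1223) (zi : Fin 31) :
    (orbitRelevant 5 FEXPS_B9 (raysOf RAYS_S2 (getL CONES_S2 c [])) (getL ORB5 zi []) = true ∧
      exitOKW' 5 (getL CWS_S2 (getL PARENT_S2 c 0) []) [1, 0, 2, 0, 0] [0, 3, 0, 0, 0] (raysOf RAYS_S2 (getL CONES_S2 c [])) (getL ORB5 zi [])
        (getL (getL TAGS_S2 c []) zi 9) = true) ∨
    (orbitRelevant 5 FEXPS_B9 (raysOf RAYS_S2 (getL CONES_S2 c [])) (getL ORB5 zi []) = false ∧ getL (getL TAGS_S2 c []) zi 9 = 9) := by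
  have h := cert_S2_exits
  obtain ⟨_, _, _, hPl, _, _, _, hCl, _, hTl, hT31, _, hO⟩ := shapes_S2
  unfold checkExitsRel at h
  simp only [Bool.and_eq_true, List.all_eq_true] at h
  obtain ⟨-, h⟩ := h
  have hmem : (getL CONES_S2 c [], (getL PARENT_S2 c 0, getL TAGS_S2 c [])) ∈ CONES_S2.zip (PARENT_S2.zip TAGS_S2) := by
    have h1 := mk_getL_mem_zip PARENT_S2 TAGS_S2 0 [] c (by rw [hPl]; exact c.2) (by rw [hTl]; exact c.2)
    have hlen2 : (c : ℕ) < (PARENT_S2.zip TAGS_S2).length := by rw [List.length_zip, hPl, hTl]; simp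
    have h2 := mk_getL_mem_zip CONES_S2 (PARENT_S2.zip TAGS_S2) [] ((0 : ℕ), ([] : List ℕ)) c (by rw [hCl]; exact c.2) hlen2
    rwa [getL_eq_getElem _ _ _ hlen2, List.getElem_zip, ← getL_eq_getElem _ _ (0 : ℕ) (by rw [hPl]; exact c.2), ← getL_eq_getElem _ _ ([] : List ℕ) (by rw [hTl]; exact c.2)] at h2
  have h' := (h _ hmem).2
  have htlen : (getL TAGS_S2 c []).length = 31 := length_of_allLen hT31 _ (getL_mem _ _ _ (by rw [hTl]; exact c.2))
  have hmem2 : (getL ORB5 zi [], getL (getL TAGS_S2 c []) zi 9) ∈ ORB5.zip (getL TAGS_S2 c []) :=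
    mk_getL_mem_zip ORB5 (getL TAGS_S2 c []) [] 9 zi (by rw [hO]; exact zi.2) (by rw [htlen]; exact zi.2)
  have h'' := h' _ hmem2
  by_cases hrel : orbitRelevant 5 FEXPS_B9 (raysOf RAYS_S2 (getL CONES_S2 (c : ℕ) [])) (getL ORB5 (zi : ℕ) []) = true
  · rw [if_pos hrel] at h''; exact Or.inl ⟨hrel, h''⟩
  · rw [if_neg hrel] at h''
    simp only [Nat.beq_eq] at h''
    exact Or.inr ⟨Bool.eq_false_iff.mpr hrel, h''⟩

end Summit.ResolutionOfSingularities.ResolutionOfSingularities.Theorems.FInjectiveMacaulayfication.ExitTagSemantics
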